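import Literature.RepresentationTheory.Paul1998.DetCoverCocycleRankOne
import Literature.RepresentationTheory.KonnoKonno2007.RealUnitaryDualPairSlices
import Literature.NumberTheory.Weil1964.ArchMetaplecticReindex
import Literature.NumberTheory.Weil1964.ArchMetaplecticTensor
import Literature.NumberTheory.Weil1964.ArchMetaplecticSplittingsHolds
import HarnessLib

/-!
# Paul 1998 (1.2.1), the parity of `r − s`: the metaplectic cover over `ι_V U(p,q) ⊂ Sp(V ⊗ W)` SPLITS when
# `r ≡ s (2)`, and for `r ≢ s (2)` its cocycle is that of ONE line — for every `(p, q)` (kernel; 0 named facts)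

Topic `RepresentationTheory/Paul1998`; namespace `Literature.RepresentationTheory.Paul1998.MetaplecticSplitting`.
Continuation of `Literature.RepresentationTheory.Paul1998.DetCoverCocycleRankOne` (the SHAPE of the conclusion — the
fields `τ, σ, pr_τ, σ_sq, τ_mul` of B08-1's `DualPairCoverDatum.CocycleSection d` valued in `Mp^𝓢(𝕎)` with `ε = −1`:
`τ : U(P,Q) → Mp^𝓢(𝕎)` over `ι_V` with metaplectic values, `σ : U(P,Q) → ℂ^×`, `σ² = det^d`, and
`τ(g₁)τ(g₂) = τ(g₁g₂)` or `(−1)·τ(g₁g₂)` according as `σ(g₁)σ(g₂) = σ(g₁g₂)` or not — and the CORE datum at the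
linearised slots `|Q| = 1`, `S = ∅`, `R ≠ ∅`, `exists_cocycleSectionV_linearised`), assembled from
`Literature.NumberTheory.Weil1964.ArchMetaplecticTensor` (`x₁ ⊠ x₂`, `IsMetaplectic.tensor`, the canonical tensor
square `tensorSq_mul_of`), `…ArchMetaplecticSplittingsHolds` (`exists_metaplectic_hom_twistedDiagonal`: the cover SPLITS
over the twisted diagonal `T ↦ T ⊕ cTc`, hypothesis-free since R1/R2 of [Folland1989, Thm. (4.37)] are tree theorems
`folland1989_Thm_4_37_ab_holds` / `_c_holds`), `…ArchMetaplecticReindex` (`MpS.reindex E` over `reindexSp E`) and the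
slice geometry `KonnoKonno2007.RealUnitaryDualPairSlices` (`ι_V` over `W₁ ⊕ W₂` is a block sum; over a hyperbolic pair it
is the twisted diagonal).

PRINT [Paul1998, §1.2 p. 389 L19–23]: «`Ũ(p, q)` is isomorphic to the `det^{(r−s)/2}`-cover of `U(p, q)`
`= {(g, z) ∈ U(p, q) × ℂ^× : z² = det(g)^{r−s}}`».  In particular the cover is TRIVIAL iff `r − s` is even
([Kudla1994, §1, Prop. 4.1; Adams2007, §3]: for `r ≡ s (2)` the character `det^{(r−s)/2}` is a genuine character and
`g ↦ (g, det(g)^{(r−s)/2})` splits it).  WHAT THIS FILE PROVES, for EVERY `P, Q` (no restriction on the real rank of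
`U(P,Q)`, no `KAK`, no vacuum character, no record):

* §1 a CALCULUS of sections of `Mp^𝓢 → Sp` over a map `φ : G → Sp(W)`: HOMOMORPHIC metaplectic sections («splittings»)
  are stable under `⊠` (`exists_hom_tensor`), relabelling (`exists_hom_reindex`), exist over the twisted diagonal
  `g ↦ φ g ⊕ c(φ g)c` (`exists_hom_twistedDiagonal`) and over the diagonal `g ↦ φ g ⊕ φ g` (`exists_hom_diagonal`, the
  canonical tensor square `x_g ⊠ x_g`); COCYCLE sections (the `CocycleSection` fields) are stable under `⊠` with a
  splitting (`cocycle_tensor_hom`), relabelling (`cocycle_reindex`), even shifts `σ ↦ σ·det^e` (`cocycle_shift`), and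
  TRANSFER across a splitting of a sum: if `g ↦ φ₁ g ⊕ φ₂ g` splits and `φ₁` carries a cocycle section with square root
  `σ`, then `φ₂` carries one with square root `σ⁻¹` (`cocycle_transfer`);
* §2 THE EVEN CASE **`exists_metaplectic_hom_ιV_of_even`**: `|R| + |S|` even ⟹ there is a HOMOMORPHISM
  `s : U(P,Q) →* Mp^𝓢(𝕎)` over `ι_V` with metaplectic values — the metaplectic double cover `Mp₂(𝕎) → Sp(𝕎)` SPLITS over
  `ι_V U(P,Q)` (`Mp₂.exists_section_ιV_of_even`), and the `CocycleSection (|R|−|S|)` fields hold with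
  `σ = det^{(|R|−|S|)/2}` (`exists_cocycleSectionV_of_even`).  Proof: `W ≅ H^{⊕m} ⊕ (L ⊕ L)^{⊕k}` with `m = min(r,s)`
  hyperbolic pairs and `k` pairs of like lines; `ι_V` is, after relabelling, the block sum of a twisted diagonal and a
  diagonal (§1), over each of which the cover splits;
* §3 THE ODD CASE **`exists_cocycleSectionV_of_odd_of_core`**: `|R| + |S|` odd ⟹ the `CocycleSection (|R|−|S|)` fields
  over `ι_V` follow from ONE core datum — the `CocycleSection 1` fields over `ι_V` for the single positive line
  `(R, S) = (Unit, Fin 0)` (for `s > r` the negative line's datum is obtained from the positive one by TRANSFER across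
  the hyperbolic-pair splitting);
* §4 UNCONDITIONAL at `|Q| = 1`: the core datum IS the tree's `exists_cocycleSectionV_linearised` (vacuum character of the
  linearised Weil datum + R1/R2 `_holds`), whence **`exists_cocycleSectionV_rankOne`**: for `U(P,Q)` with `|Q| = 1`
  (e.g. the Picard group `U(2,1)`) and EVERY `(R, S)`, the `CocycleSection (|R|−|S|)` fields over `ι_V` hold — print's
  (1.2.1), `V`-side, with NO hypothesis.

What is NOT here: the core datum for `min(|P|,|Q|) ≥ 2` (general `KAK`, [Knapp2002, Thm. 7.39]) — there the odd case
stays relative to the `CocycleSection 1` datum of one line; the `W`-side (symmetric, via `JunctionSwapSymmetry`); the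
topology (B08-2-1b).  Hypotheses used: none (0 named facts; net debt 0).

## References

* [Paul1998] A. Paul, *Howe correspondence for real unitary groups*, J. Funct. Anal. 159 (1998) 384–431, §1.2
  (1.2.1)–(1.2.2) p. 389 L11–29.
* [Kudla1994] S. Kudla, *Splitting metaplectic covers of dual reductive pairs*, Israel J. Math. 87 (1994) 361–401, §1,
  Prop. 4.1.
* [Adams2007] J. Adams, *The theta correspondence over ℝ*, in: Harmonic Analysis, Group Representations, Automorphic Forms
  and Invariant Theory, World Scientific 2007, §3.
* [MoeglinVignerasWaldspurger1987] C. Mœglin, M.-F. Vignéras, J.-L. Waldspurger, LNM 1291 (1987), Chap. 2 II.1 (6).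
* [Folland1989] G. B. Folland, *Harmonic Analysis in Phase Space*, Princeton UP 1989, Thm. (4.37), Prop. (4.39).
-/

set_option autoImplicit false
-- the index types `DPIdx P Q R S ⊕ DPIdx P Q R′ S′` are deep sums of products: instance synthesis needs room
set_option synthInstance.maxSize 1024

noncomputable section

open MeasureTheory Complex SchwartzMap
open scoped InnerProductSpace ComplexConjugate

namespace Literature.RepresentationTheory.Paul1998

namespace MetaplecticSplitting

open Literature.Analysis.SegalBargmann Literature.RepresentationTheory.HeisenbergGroup
open Literature.NumberTheory.Weil1964 Literature.NumberTheory.Weil1964.MpS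
open Literature.NumberTheory.Automorphic Literature.NumberTheory.Automorphic.UnitaryGroup
open Literature.RepresentationTheory.KonnoKonno2007 Literature.RepresentationTheory.KonnoKonno2007.RealDualPair

/-! ## 1. A calculus of homomorphic and cocycle sections of `Mp^𝓢 → Sp` -/

section Calculus

variable {G : Type*} [Group G]
variable {σ σ' σ₁ σ₂ : Type*} [Fintype σ] [DecidableEq σ] [Fintype σ'] [DecidableEq σ'] [Fintype σ₁] [DecidableEq σ₁]
  [Fintype σ₂] [DecidableEq σ₂]

/-- **Splittings are stable under `⊠`**: homomorphic metaplectic sections over `φ₁` and `φ₂` give one over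
`g ↦ φ₁ g ⊕ φ₂ g`. [cite: MoeglinVignerasWaldspurger1987, Chap. 2 II.1 (6); Kudla1994, §1] -/
theorem exists_hom_tensor (φ₁ : G → symplecticGroup (polar (dotPairing σ₁)))
    (φ₂ : G → symplecticGroup (polar (dotPairing σ₂))) (s₁ : G →* MpS σ₁) (s₂ : G →* MpS σ₂)
    (h₁ : ∀ g, proj (s₁ g) = φ₁ g) (h₁' : ∀ g, IsMetaplectic (s₁ g)) (h₂ : ∀ g, proj (s₂ g) = φ₂ g)
    (h₂' : ∀ g, IsMetaplectic (s₂ g)) :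
    ∃ s : G →* MpS (σ₁ ⊕ σ₂), (∀ g, proj (s g) = spBlock (φ₁ g, φ₂ g)) ∧ ∀ g, IsMetaplectic (s g) :=
  ⟨tensorHom.comp (s₁.prod s₂), fun g => by
    rw [MonoidHom.comp_apply, MonoidHom.prod_apply, tensorHom_apply, proj_tensor, h₁, h₂],
    fun g => (h₁' g).tensor (h₂' g)⟩

/-- **Splittings are stable under relabelling** of the coordinates. [cite: Weil1964, Chap. I n° 12; Kudla1994, §1] -/
theorem exists_hom_reindex (E : σ ≃ σ') (φ : G → symplecticGroup (polar (dotPairing σ'))) (s : G →* MpS σ')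
    (h : ∀ g, proj (s g) = φ g)
    (h' : ∀ g, IsMetaplectic (s g)) :
    ∃ s' : G →* MpS σ, (∀ g, proj (s' g) = reindexSp E (φ g)) ∧ ∀ g, IsMetaplectic (s' g) :=
  ⟨(MpS.reindex E).comp s, fun g => by rw [MonoidHom.comp_apply, proj_reindex, h], fun g => (h' g).reindex E⟩

/-- **The cover splits over a twisted diagonal** `g ↦ φ g ⊕ c (φ g) c` (the doubling section of
`ArchMetaplecticSplittingsHolds`, pulled back along `φ`). [cite: Kudla1994, §1, Prop. 4.1; Folland1989, Thm. (4.37)] -/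
theorem exists_hom_twistedDiagonal (φ : G →* symplecticGroup (polar (dotPairing σ))) :
    ∃ s : G →* MpS (σ ⊕ σ), (∀ g, proj (s g) = spBlock (φ g, Sp.conjSp σ (φ g))) ∧ ∀ g, IsMetaplectic (s g) := by
  obtain ⟨s, hs⟩ := exists_metaplectic_hom_twistedDiagonal (σ := σ)
  exact ⟨s.comp φ, fun g => (hs (φ g)).1, fun g => (hs (φ g)).2⟩

/-- **The cover splits over a diagonal** `g ↦ φ g ⊕ φ g`, CANONICALLY: `g ↦ x_g ⊠ x_g` for either metaplectic `x_g`
over `φ g` (`tensorSq_mul_of`; R1/R2 are tree theorems). [cite: MoeglinVignerasWaldspurger1987, Chap. 2 II.1 (6); Kudla1994, §1] -/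
theorem exists_hom_diagonal (φ : G →* symplecticGroup (polar (dotPairing σ))) :
    ∃ s : G →* MpS (σ ⊕ σ), (∀ g, proj (s g) = spBlock (φ g, φ g)) ∧ ∀ g, IsMetaplectic (s g) := by
  have hx : ∀ g, ∃ x : MpS σ, proj x = φ g ∧ IsMetaplectic x := fun g => folland1989_Thm_4_37_ab_holds σ (φ g)
  choose x hxp hxm using hx
  have hmul : ∀ g₁ g₂, MpS.tensor (x (g₁ * g₂)) (x (g₁ * g₂)) =
      MpS.tensor (x g₁) (x g₁) * MpS.tensor (x g₂) (x g₂) := fun g₁ g₂ =>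
    tensorSq_mul_of ((folland1989_Thm_4_37_c_holds σ _ _ (hxm g₁) (hxm g₂)).eq_or_eq_negOne_mul (hxm _)
      (by rw [map_mul, hxp, hxp, hxp, map_mul]))
  exact ⟨MonoidHom.mk' (fun g => MpS.tensor (x g) (x g)) hmul, fun g => by
    rw [MonoidHom.mk'_apply, proj_tensor, hxp], fun g => (hxm g).tensorSq⟩

/-- **A cocycle section tensored with a splitting is a cocycle section with the same square root.**
[cite: MoeglinVignerasWaldspurger1987, Chap. 2 II.1 (6); Paul1998, §1.2 (1.2.1)] -/
theorem cocycle_tensor_hom (φ₁ : G → symplecticGroup (polar (dotPairing σ₁)))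
    (φ₂ : G → symplecticGroup (polar (dotPairing σ₂))) (s : G →* MpS σ₁) (hs : ∀ g, proj (s g) = φ₁ g)
    (hs' : ∀ g, IsMetaplectic (s g)) (τ : G → MpS σ₂) (sg : G → ℂˣ) (hτ : ∀ g, proj (τ g) = φ₂ g)
    (hτ' : ∀ g, IsMetaplectic (τ g))
    (hmul : ∀ g₁ g₂, τ g₁ * τ g₂ = (if sg g₁ * sg g₂ = sg (g₁ * g₂) then 1 else negOne) * τ (g₁ * g₂)) :
    ∃ τ' : G → MpS (σ₁ ⊕ σ₂), (∀ g, proj (τ' g) = spBlock (φ₁ g, φ₂ g)) ∧ (∀ g, IsMetaplectic (τ' g)) ∧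
      ∀ g₁ g₂, τ' g₁ * τ' g₂ = (if sg g₁ * sg g₂ = sg (g₁ * g₂) then 1 else negOne) * τ' (g₁ * g₂) := by
  refine ⟨fun g => MpS.tensor (s g) (τ g), fun g => by rw [proj_tensor, hs, hτ], fun g => (hs' g).tensor (hτ' g),
    fun g₁ g₂ => ?_⟩
  show MpS.tensor (s g₁) (τ g₁) * MpS.tensor (s g₂) (τ g₂) = _
  rw [← tensor_mul, ← map_mul, hmul]
  split_ifs
  · rw [one_mul, one_mul]
  · rw [tensor_negOne_mul_right]

/-- **A cocycle section relabelled is a cocycle section with the same square root.** [cite: Weil1964, Chap. I n° 12; Paul1998, §1.2 (1.2.1)] -/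
theorem cocycle_reindex (E : σ ≃ σ') (φ : G → symplecticGroup (polar (dotPairing σ'))) (τ : G → MpS σ') (sg : G → ℂˣ)
    (hτ : ∀ g, proj (τ g) = φ g)
    (hτ' : ∀ g, IsMetaplectic (τ g))
    (hmul : ∀ g₁ g₂, τ g₁ * τ g₂ = (if sg g₁ * sg g₂ = sg (g₁ * g₂) then 1 else negOne) * τ (g₁ * g₂)) :
    ∃ τ' : G → MpS σ, (∀ g, proj (τ' g) = reindexSp E (φ g)) ∧ (∀ g, IsMetaplectic (τ' g)) ∧
      ∀ g₁ g₂, τ' g₁ * τ' g₂ = (if sg g₁ * sg g₂ = sg (g₁ * g₂) then 1 else negOne) * τ' (g₁ * g₂) := by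
  refine ⟨fun g => MpS.reindex E (τ g), fun g => by rw [proj_reindex, hτ], fun g => (hτ' g).reindex E, fun g₁ g₂ => ?_⟩
  show MpS.reindex E (τ g₁) * MpS.reindex E (τ g₂) = _
  rw [← map_mul, hmul, map_mul]
  split_ifs
  · rw [map_one]
  · rw [reindex_negOne]

omit [DecidableEq σ] in
/-- **Even shift of the square root**: `σ ↦ σ · χ^e` for a CHARACTER `χ` (here `det`) keeps the coboundary and moves the
exponent by `2e` (B08-1's `CocycleSection.shift`, `Mp^𝓢`-valued form). [cite: Paul1998, §1.2 (1.2.2) p. 389 L27–29] -/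
theorem cocycle_shift (χ : G →* ℂˣ) (τ : G → MpS σ) (sg : G → ℂˣ) {d : ℤ} (e : ℤ) {d' : ℤ} (hd : d + 2 * e = d')
    (hsq : ∀ g, sg g ^ 2 = χ g ^ d)
    (hmul : ∀ g₁ g₂, τ g₁ * τ g₂ = (if sg g₁ * sg g₂ = sg (g₁ * g₂) then 1 else negOne) * τ (g₁ * g₂)) :
    ∃ sg' : G → ℂˣ, (∀ g, sg' g ^ 2 = χ g ^ d') ∧
      ∀ g₁ g₂, τ g₁ * τ g₂ = (if sg' g₁ * sg' g₂ = sg' (g₁ * g₂) then 1 else negOne) * τ (g₁ * g₂) := by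
  refine ⟨fun g => sg g * χ g ^ e, fun g => ?_, fun g₁ g₂ => ?_⟩
  · rw [mul_pow, hsq, ← zpow_natCast (χ g ^ e), ← zpow_mul, ← zpow_add, ← hd]
    congr 1
    push_cast
    ring
  · have hiff : (sg g₁ * χ g₁ ^ e * (sg g₂ * χ g₂ ^ e) = sg (g₁ * g₂) * χ (g₁ * g₂) ^ e) ↔
        (sg g₁ * sg g₂ = sg (g₁ * g₂)) := by
      rw [map_mul, mul_zpow, mul_mul_mul_comm, mul_left_inj]
    rw [hmul]
    simp only [hiff]

/-- the sign defect of a pointwise-metaplectic section is `±1`. [cite: Folland1989, Thm. (4.37), p. 161 L12–14] -/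
theorem exists_sign_of_isMetaplectic (φ : G →* symplecticGroup (polar (dotPairing σ))) (τ : G → MpS σ)
    (hτ : ∀ g, proj (τ g) = φ g)
    (hτ' : ∀ g, IsMetaplectic (τ g)) (g₁ g₂ : G) :
    τ g₁ * τ g₂ = τ (g₁ * g₂) ∨ τ g₁ * τ g₂ = negOne * τ (g₁ * g₂) :=
  (hτ' (g₁ * g₂)).eq_or_eq_negOne_mul (folland1989_Thm_4_37_c_holds σ _ _ (hτ' g₁) (hτ' g₂))
    (by rw [map_mul, hτ, hτ, hτ, map_mul])

/-- **TRANSFER across a splitting of a sum.**  If `g ↦ φ₁ g ⊕ φ₂ g` carries a homomorphic metaplectic section `s` and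
`φ₁` carries a cocycle section `(τ₁, σ)`, then `φ₂` carries a cocycle section with square root `σ⁻¹`: choose metaplectic
`ζ_g` over `φ₂ g`, re-sign it so that `τ₁(g) ⊠ τ₂(g) = s(g)`; multiplicativity of `s` and of `⊠` then forces the defect
of `τ₂` to equal that of `τ₁`. [cite: Kudla1994, §1, Prop. 4.1; MoeglinVignerasWaldspurger1987, Chap. 2 II.1 (6)] -/
theorem cocycle_transfer (φ₁ : G →* symplecticGroup (polar (dotPairing σ₁)))
    (φ₂ : G →* symplecticGroup (polar (dotPairing σ₂))) (s : G →* MpS (σ₁ ⊕ σ₂))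
    (hs : ∀ g, proj (s g) = spBlock (φ₁ g, φ₂ g)) (hs' : ∀ g, IsMetaplectic (s g)) (τ₁ : G → MpS σ₁) (sg : G → ℂˣ)
    (h₁ : ∀ g, proj (τ₁ g) = φ₁ g) (h₁' : ∀ g, IsMetaplectic (τ₁ g))
    (hmul : ∀ g₁ g₂, τ₁ g₁ * τ₁ g₂ = (if sg g₁ * sg g₂ = sg (g₁ * g₂) then 1 else negOne) * τ₁ (g₁ * g₂)) :
    ∃ τ₂ : G → MpS σ₂, (∀ g, proj (τ₂ g) = φ₂ g) ∧ (∀ g, IsMetaplectic (τ₂ g)) ∧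
      ∀ g₁ g₂, τ₂ g₁ * τ₂ g₂ =
        (if (sg g₁)⁻¹ * (sg g₂)⁻¹ = (sg (g₁ * g₂))⁻¹ then 1 else negOne) * τ₂ (g₁ * g₂) := by
  -- a pointwise metaplectic lift of `φ₂`, re-signed so that `τ₁ ⊠ τ₂ = s`
  have hζ : ∀ g, ∃ z : MpS σ₂, proj z = φ₂ g ∧ IsMetaplectic z := fun g => folland1989_Thm_4_37_ab_holds σ₂ (φ₂ g)
  choose ζ hζp hζm using hζ
  have hfib : ∀ g, ∃ τ₂ : MpS σ₂, proj τ₂ = φ₂ g ∧ IsMetaplectic τ₂ ∧ MpS.tensor (τ₁ g) τ₂ = s g := fun g => by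
    rcases ((h₁' g).tensor (hζm g)).eq_or_eq_negOne_mul (hs' g)
        (by rw [proj_tensor, h₁, hζp, hs]) with h | h
    · exact ⟨ζ g, hζp g, hζm g, h.symm⟩
    · refine ⟨negOne * ζ g, by rw [map_mul, proj_negOne, one_mul, hζp], (hζm g).negOne_mul, ?_⟩
      rw [tensor_negOne_mul_right, h]
  choose τ₂ h₂ h₂' htens using hfib
  refine ⟨τ₂, h₂, h₂', fun g₁ g₂ => ?_⟩
  -- the defects `c₁` of `τ₁` and `c₂` of `τ₂` at `(g₁, g₂)`, as elements of `{1, −1}`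
  obtain ⟨c₁, hc₁def, hc₁⟩ : ∃ c₁ : MpS σ₁, c₁ = (if sg g₁ * sg g₂ = sg (g₁ * g₂) then 1 else negOne) ∧
      (c₁ = 1 ∨ c₁ = negOne) := ⟨_, rfl, by split_ifs <;> simp⟩
  have hτ₁ : τ₁ g₁ * τ₁ g₂ = c₁ * τ₁ (g₁ * g₂) := by rw [hc₁def]; exact hmul g₁ g₂
  obtain ⟨c₂, hc₂', hτ₂⟩ : ∃ c₂ : MpS σ₂, (c₂ = 1 ∨ c₂ = negOne) ∧ τ₂ g₁ * τ₂ g₂ = c₂ * τ₂ (g₁ * g₂) := by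
    rcases exists_sign_of_isMetaplectic φ₂ τ₂ h₂ h₂' g₁ g₂ with h | h
    · exact ⟨1, Or.inl rfl, by rw [one_mul]; exact h⟩
    · exact ⟨negOne, Or.inr rfl, h⟩
  -- `s(g₁) s(g₂) = s(g₁ g₂)` read through `⊠`: `(c₁ ⊠ c₂) · (τ₁ ⊠ τ₂)(g₁g₂) = (τ₁ ⊠ τ₂)(g₁g₂)`
  have key : MpS.tensor c₁ c₂ * MpS.tensor (τ₁ (g₁ * g₂)) (τ₂ (g₁ * g₂)) =
      MpS.tensor (τ₁ (g₁ * g₂)) (τ₂ (g₁ * g₂)) := by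
    rw [← tensor_mul, ← hτ₁, ← hτ₂, tensor_mul, htens, htens, htens, map_mul]
  -- `c₁ ⊠ c₂ ∈ {1, −1}` and equals `1`, so `c₁ = c₂`
  have hcc : c₁ = 1 ∧ c₂ = 1 ∨ c₁ = negOne ∧ c₂ = negOne := by
    rcases hc₁ with h1 | h1 <;> rcases hc₂' with h2 | h2
    · exact Or.inl ⟨h1, h2⟩
    · exfalso
      rw [h1, h2, tensor_one_negOne] at key
      exact negOne_mul_ne_self _ key
    · exfalso
      rw [h1, h2, tensor_negOne_one] at key
      exact negOne_mul_ne_self _ key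
    · exact Or.inr ⟨h1, h2⟩
  have hiff : ((sg g₁)⁻¹ * (sg g₂)⁻¹ = (sg (g₁ * g₂))⁻¹) ↔ (sg g₁ * sg g₂ = sg (g₁ * g₂)) := by
    rw [← mul_inv, inv_inj]
  rw [hτ₂]
  by_cases hq : sg g₁ * sg g₂ = sg (g₁ * g₂)
  · rw [if_pos (hiff.2 hq)]
    rcases hcc with ⟨-, h2⟩ | ⟨h1, -⟩
    · rw [h2]
    · exfalso
      rw [hc₁def, if_pos hq] at h1
      exact negOne_ne_one h1.symm
  · rw [if_neg fun h => hq (hiff.1 h)]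
    rcases hcc with ⟨h1, -⟩ | ⟨-, h2⟩
    · exfalso
      rw [hc₁def, if_neg hq] at h1
      exact negOne_ne_one h1
    · rw [h2]

end Calculus

/-! ## 2. The even case: the cover splits over `ι_V U(P,Q)` when `|R| ≡ |S| (2)` -/

section Even

variable {P Q : Type*} [Fintype P] [DecidableEq P] [Fintype Q] [DecidableEq Q]

set_option maxHeartbeats 1600000 in -- deep index types: slow instance unification
/-- **the cover splits over `ι_V` for a sum of hyperbolic pairs** `W = H^{⊕T}` (`R = S = T`): twisted diagonal.
[cite: Kudla1994, §1, Prop. 4.1; Paul1998, §1.2 (1.2.1)] -/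
theorem exists_metaplectic_hom_ιV_pair (T : Type*) [Fintype T] [DecidableEq T] :
    ∃ s : UForm P Q →* MpS (DPIdx P Q T T), (∀ g, proj (s g) = ι𝕎 P Q T T (g, 1)) ∧ ∀ g, IsMetaplectic (s g) := by
  obtain ⟨s₀, hs₀, hs₀'⟩ := exists_hom_twistedDiagonal (G := UForm P Q) (UnitaryDualPairCover.ιV P Q T (Fin 0))
  obtain ⟨s, hs, hs'⟩ := exists_hom_reindex (G := UForm P Q) (dpIdxPairEquiv P Q T (Fin 0)).symm
    (fun g => spBlock (ι𝕎 P Q T (Fin 0) (g, 1), Sp.conjSp _ (ι𝕎 P Q T (Fin 0) (g, 1)))) s₀ hs₀ hs₀'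
  exact ⟨s, fun g => by rw [hs, ιV_pair_eq_reindexSp (S₀ := Fin 0) g], hs'⟩

set_option maxHeartbeats 1600000 in -- deep index types: slow instance unification
/-- **the cover splits over `ι_V` for a doubled frame** `(R, S) = (A ⊕ A, B ⊕ B)`: diagonal, canonical tensor square.
[cite: MoeglinVignerasWaldspurger1987, Chap. 2 II.1 (6); Kudla1994, §1] -/
theorem exists_metaplectic_hom_ιV_double (A B : Type*) [Fintype A] [DecidableEq A] [Fintype B] [DecidableEq B] :
    ∃ s : UForm P Q →* MpS (DPIdx P Q (A ⊕ A) (B ⊕ B)),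
      (∀ g, proj (s g) = ι𝕎 P Q (A ⊕ A) (B ⊕ B) (g, 1)) ∧ ∀ g, IsMetaplectic (s g) := by
  obtain ⟨s₀, hs₀, hs₀'⟩ := exists_hom_diagonal (G := UForm P Q) (UnitaryDualPairCover.ιV P Q A B)
  obtain ⟨s, hs, hs'⟩ := exists_hom_reindex (G := UForm P Q) (dpIdxSumEquiv P Q A B A B).symm
    (fun g => spBlock (ι𝕎 P Q A B (g, 1), ι𝕎 P Q A B (g, 1))) s₀ hs₀ hs₀'
  exact ⟨s, fun g => by rw [hs, ιV_sum_eq_reindexSp (R₁ := A) (S₁ := B) (R₂ := A) (S₂ := B) g], hs'⟩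

set_option maxHeartbeats 1600000 in -- deep index types: slow instance unification
/-- **the cover splits over `ι_V` for the model frame** `(T ⊕ (A ⊕ A), T ⊕ (B ⊕ B))`. [cite: Kudla1994, §1, Prop. 4.1] -/
theorem exists_metaplectic_hom_ιV_model (T A B : Type*) [Fintype T] [DecidableEq T] [Fintype A] [DecidableEq A]
    [Fintype B] [DecidableEq B] :
    ∃ s : UForm P Q →* MpS (DPIdx P Q (T ⊕ (A ⊕ A)) (T ⊕ (B ⊕ B))),
      (∀ g, proj (s g) = ι𝕎 P Q (T ⊕ (A ⊕ A)) (T ⊕ (B ⊕ B)) (g, 1)) ∧ ∀ g, IsMetaplectic (s g) := by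
  obtain ⟨s₁, h₁, h₁'⟩ := exists_metaplectic_hom_ιV_pair (P := P) (Q := Q) T
  obtain ⟨s₂, h₂, h₂'⟩ := exists_metaplectic_hom_ιV_double (P := P) (Q := Q) A B
  obtain ⟨s₀, h₀, h₀'⟩ := exists_hom_tensor (G := UForm P Q) (fun g => ι𝕎 P Q T T (g, 1))
    (fun g => ι𝕎 P Q (A ⊕ A) (B ⊕ B) (g, 1)) s₁ s₂ h₁ h₁' h₂ h₂'
  obtain ⟨s, hs, hs'⟩ := exists_hom_reindex (G := UForm P Q) (dpIdxSumEquiv P Q T T (A ⊕ A) (B ⊕ B)).symm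
    (fun g => spBlock (ι𝕎 P Q T T (g, 1), ι𝕎 P Q (A ⊕ A) (B ⊕ B) (g, 1))) s₀ h₀ h₀'
  exact ⟨s, fun g => by rw [hs, ιV_sum_eq_reindexSp (R₁ := T) (S₁ := T) (R₂ := A ⊕ A) (S₂ := B ⊕ B) g], hs'⟩

set_option maxHeartbeats 1600000 in -- deep index types: slow instance unification
/-- **relabelling a splitting over `ι_V`** along `R₀ ≃ R`, `S₀ ≃ S`. [cite: Weil1964, Chap. I n° 12; Kudla1994, §1] -/
theorem exists_metaplectic_hom_ιV_of_equiv {R S R₀ S₀ : Type*} [Fintype R] [DecidableEq R] [Fintype S]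
    [DecidableEq S] [Fintype R₀] [DecidableEq R₀] [Fintype S₀] [DecidableEq S₀] (eR : R₀ ≃ R) (eS : S₀ ≃ S)
    (h : ∃ s : UForm P Q →* MpS (DPIdx P Q R₀ S₀), (∀ g, proj (s g) = ι𝕎 P Q R₀ S₀ (g, 1)) ∧ ∀ g, IsMetaplectic (s g)) :
    ∃ s : UForm P Q →* MpS (DPIdx P Q R S), (∀ g, proj (s g) = ι𝕎 P Q R S (g, 1)) ∧ ∀ g, IsMetaplectic (s g) := by
  obtain ⟨s₀, h₀, h₀'⟩ := h
  obtain ⟨s, hs, hs'⟩ :=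
    exists_hom_reindex (G := UForm P Q) (dpIdxCongr P Q R₀ S₀ P Q R S (Equiv.refl P) (Equiv.refl Q) eR eS).symm
      (fun g => ι𝕎 P Q R₀ S₀ (g, 1)) s₀ h₀ h₀'
  exact ⟨s, fun g => by rw [hs, ιV_relabel eR eS g], hs'⟩

/-- arithmetic of the even case: `r + s` even ⟹ `r = m + 2a`, `s = m + 2b` with `m = min(r, s)`. [folklore] -/
private theorem even_decomp {r s : ℕ} (h : Even (r + s)) :
    ∃ m a b : ℕ, r = m + (a + a) ∧ s = m + (b + b) := by
  obtain ⟨k, hk⟩ := h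
  rcases le_total s r with hsr | hrs
  · obtain ⟨t, rfl⟩ := Nat.exists_eq_add_of_le hsr
    exact ⟨s, k - s, 0, by omega, by omega⟩
  · obtain ⟨t, rfl⟩ := Nat.exists_eq_add_of_le hrs
    exact ⟨r, 0, k - r, by omega, by omega⟩

variable {R S : Type*} [Fintype R] [DecidableEq R] [Fintype S] [DecidableEq S]

/-- **THE EVEN CASE — the metaplectic double cover SPLITS over `ι_V U(P,Q)` when `|R| ≡ |S| (2)`**, for every `P, Q`:
there is a homomorphism `s : U(P,Q) →* Mp^𝓢(𝕎)` over `ι_V` with metaplectic values.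
[cite: Kudla1994, §1, Prop. 4.1; Paul1998, §1.2 (1.2.1) p. 389 L19–23; Adams2007, §3] -/
theorem exists_metaplectic_hom_ιV_of_even (h : Even (Fintype.card R + Fintype.card S)) :
    ∃ s : UForm P Q →* MpS (DPIdx P Q R S), (∀ g, proj (s g) = ι𝕎 P Q R S (g, 1)) ∧ ∀ g, IsMetaplectic (s g) := by
  obtain ⟨m, a, b, hr, hs⟩ := even_decomp h
  have eR : Fin m ⊕ (Fin a ⊕ Fin a) ≃ R :=
    Fintype.equivOfCardEq (by simp only [Fintype.card_sum, Fintype.card_fin]; omega)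
  have eS : Fin m ⊕ (Fin b ⊕ Fin b) ≃ S :=
    Fintype.equivOfCardEq (by simp only [Fintype.card_sum, Fintype.card_fin]; omega)
  exact exists_metaplectic_hom_ιV_of_equiv eR eS (exists_metaplectic_hom_ιV_model (Fin m) (Fin a) (Fin b))

/-- **… as a section of `pr : Mp₂(𝕎) → Sp(𝕎)`**: a homomorphism `s : U(P,Q) →* Mp₂(𝕎)` with `pr ∘ s = ι_V`.
[cite: Kudla1994, §1, Prop. 4.1; Paul1998, §1.2 (1.2.1) p. 389 L19–23] -/
theorem Mp₂.exists_section_ιV_of_even (h : Even (Fintype.card R + Fintype.card S)) :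
    ∃ s : UForm P Q →* Mp₂ (DPIdx P Q R S), ∀ g, Mp₂.pr (s g) = ι𝕎 P Q R S (g, 1) := by
  obtain ⟨s, hs, hs'⟩ := exists_metaplectic_hom_ιV_of_even (P := P) (Q := Q) (R := R) (S := S) h
  exact ⟨s.codRestrict (Mp₂ _) fun g => Mp₂.mem_of_isMetaplectic (hs' g), fun g => hs g⟩

/-- `det : U(P,Q) →* ℂ^×` unfolded. [folklore] -/
private theorem detHom_apply' (g : UForm P Q) :
    UForm.detHom P Q g = Matrix.GeneralLinearGroup.det (g : GL (P ⊕ Q) ℂ) := rfl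

/-- **THE EVEN CASE in the `CocycleSection` currency**: for `|R| ≡ |S| (2)` the fields `τ, σ, pr_τ, σ_sq, τ_mul` of
B08-1's `CocycleSection (|R| − |S|)` hold over `ι_V` with `τ` a HOMOMORPHISM and `σ = det^{(|R|−|S|)/2}` (a genuine
character, so the sign in `τ_mul` is always `+`). [cite: Paul1998, §1.2 (1.2.1)–(1.2.2) p. 389 L11–29; Kudla1994, Prop. 4.1] -/
theorem exists_cocycleSectionV_of_even (h : Even (Fintype.card R + Fintype.card S)) :
    ∃ (τ : UForm P Q → MpS (DPIdx P Q R S)) (σ : UForm P Q → ℂˣ),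
      (∀ g, proj (τ g) = ι𝕎 P Q R S (g, 1)) ∧ (∀ g, IsMetaplectic (τ g)) ∧
      (∀ g, σ g ^ 2 = Matrix.GeneralLinearGroup.det (g : GL (P ⊕ Q) ℂ) ^ ((Fintype.card R : ℤ) - Fintype.card S)) ∧
      ∀ g₁ g₂, τ g₁ * τ g₂ = (if σ g₁ * σ g₂ = σ (g₁ * g₂) then 1 else negOne) * τ (g₁ * g₂) := by
  obtain ⟨s, hs, hs'⟩ := exists_metaplectic_hom_ιV_of_even (P := P) (Q := Q) (R := R) (S := S) h
  have hev : Even ((Fintype.card R : ℤ) - Fintype.card S) := by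
    obtain ⟨k, hk⟩ := h
    exact ⟨(k : ℤ) - Fintype.card S, by omega⟩
  obtain ⟨e, he⟩ := hev
  refine ⟨s, fun g => UForm.detHom P Q g ^ e, hs, hs', fun g => ?_, fun g₁ g₂ => ?_⟩
  · dsimp only
    rw [← zpow_natCast, ← zpow_mul, he, detHom_apply']
    congr 1
    push_cast
    ring
  · dsimp only
    rw [if_pos (by rw [map_mul, mul_zpow]), one_mul, map_mul]

end Even

/-! ## 3. The odd case: reduction to the core datum of ONE line -/

section Odd

variable {P Q : Type*} [Fintype P] [DecidableEq P] [Fintype Q] [DecidableEq Q]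

set_option maxHeartbeats 1600000 in -- deep index types: slow instance unification
/-- relabelling a cocycle section over `ι_V` along `R₀ ≃ R`, `S₀ ≃ S`. [cite: Weil1964, Chap. I n° 12; Paul1998, §1.2 (1.2.1)] -/
private theorem cocycleSectionV_of_equiv {R S R₀ S₀ : Type*} [Fintype R] [DecidableEq R] [Fintype S] [DecidableEq S]
    [Fintype R₀] [DecidableEq R₀] [Fintype S₀] [DecidableEq S₀] (eR : R₀ ≃ R) (eS : S₀ ≃ S) {d : ℤ}
    (h : ∃ (τ : UForm P Q → MpS (DPIdx P Q R₀ S₀)) (σ : UForm P Q → ℂˣ),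
        (∀ g, proj (τ g) = ι𝕎 P Q R₀ S₀ (g, 1)) ∧ (∀ g, IsMetaplectic (τ g)) ∧
        (∀ g, σ g ^ 2 = Matrix.GeneralLinearGroup.det (g : GL (P ⊕ Q) ℂ) ^ (d : ℤ)) ∧
        ∀ g₁ g₂, τ g₁ * τ g₂ = (if σ g₁ * σ g₂ = σ (g₁ * g₂) then 1 else negOne) * τ (g₁ * g₂)) :
    ∃ (τ : UForm P Q → MpS (DPIdx P Q R S)) (σ : UForm P Q → ℂˣ),
      (∀ g, proj (τ g) = ι𝕎 P Q R S (g, 1)) ∧ (∀ g, IsMetaplectic (τ g)) ∧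
      (∀ g, σ g ^ 2 = Matrix.GeneralLinearGroup.det (g : GL (P ⊕ Q) ℂ) ^ (d : ℤ)) ∧
      ∀ g₁ g₂, τ g₁ * τ g₂ = (if σ g₁ * σ g₂ = σ (g₁ * g₂) then 1 else negOne) * τ (g₁ * g₂) := by
  obtain ⟨τ₀, σ, h₀, h₀', hσ, hmul⟩ := h
  obtain ⟨τ, hτ, hτ', hmul'⟩ :=
    cocycle_reindex (G := UForm P Q) (dpIdxCongr P Q R₀ S₀ P Q R S (Equiv.refl P) (Equiv.refl Q) eR eS).symm
      (fun g => ι𝕎 P Q R₀ S₀ (g, 1)) τ₀ σ h₀ h₀' hmul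
  exact ⟨τ, σ, fun g => by rw [hτ, ιV_relabel eR eS g], hτ', hσ, hmul'⟩

set_option maxHeartbeats 1600000 in -- deep index types: slow instance unification
/-- a splitting over `ι_V^{R₁,S₁}` tensored with a cocycle section over `ι_V^{R₂,S₂}` is a cocycle section over
`ι_V^{R₁ ⊕ R₂, S₁ ⊕ S₂}` (same exponent). [cite: MoeglinVignerasWaldspurger1987, Chap. 2 II.1 (6); Paul1998, §1.2 (1.2.1)] -/
private theorem cocycleSectionV_sum {R₁ S₁ R₂ S₂ : Type*} [Fintype R₁] [DecidableEq R₁] [Fintype S₁] [DecidableEq S₁]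
    [Fintype R₂] [DecidableEq R₂] [Fintype S₂] [DecidableEq S₂]
    (h₁ : ∃ s : UForm P Q →* MpS (DPIdx P Q R₁ S₁), (∀ g, proj (s g) = ι𝕎 P Q R₁ S₁ (g, 1)) ∧ ∀ g, IsMetaplectic (s g))
    {d : ℤ} (h₂ : ∃ (τ : UForm P Q → MpS (DPIdx P Q R₂ S₂)) (σ : UForm P Q → ℂˣ),
        (∀ g, proj (τ g) = ι𝕎 P Q R₂ S₂ (g, 1)) ∧ (∀ g, IsMetaplectic (τ g)) ∧
        (∀ g, σ g ^ 2 = Matrix.GeneralLinearGroup.det (g : GL (P ⊕ Q) ℂ) ^ (d : ℤ)) ∧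
        ∀ g₁ g₂, τ g₁ * τ g₂ = (if σ g₁ * σ g₂ = σ (g₁ * g₂) then 1 else negOne) * τ (g₁ * g₂)) :
    ∃ (τ : UForm P Q → MpS (DPIdx P Q (R₁ ⊕ R₂) (S₁ ⊕ S₂))) (σ : UForm P Q → ℂˣ),
      (∀ g, proj (τ g) = ι𝕎 P Q (R₁ ⊕ R₂) (S₁ ⊕ S₂) (g, 1)) ∧ (∀ g, IsMetaplectic (τ g)) ∧
      (∀ g, σ g ^ 2 = Matrix.GeneralLinearGroup.det (g : GL (P ⊕ Q) ℂ) ^ (d : ℤ)) ∧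
      ∀ g₁ g₂, τ g₁ * τ g₂ = (if σ g₁ * σ g₂ = σ (g₁ * g₂) then 1 else negOne) * τ (g₁ * g₂) := by
  obtain ⟨s, hs, hs'⟩ := h₁
  obtain ⟨τ₂, σ, h₂p, h₂m, hσ, hmul⟩ := h₂
  obtain ⟨τ₀, h₀, h₀', hmul₀⟩ := cocycle_tensor_hom (G := UForm P Q) (fun g => ι𝕎 P Q R₁ S₁ (g, 1))
    (fun g => ι𝕎 P Q R₂ S₂ (g, 1)) s hs hs' τ₂ σ h₂p h₂m hmul
  obtain ⟨τ, hτ, hτ', hmul'⟩ := cocycle_reindex (G := UForm P Q) (dpIdxSumEquiv P Q R₁ S₁ R₂ S₂).symm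
    (fun g => spBlock (ι𝕎 P Q R₁ S₁ (g, 1), ι𝕎 P Q R₂ S₂ (g, 1))) τ₀ σ h₀ h₀' hmul₀
  exact ⟨τ, σ, fun g => by rw [hτ, ιV_sum_eq_reindexSp (R₁ := R₁) (S₁ := S₁) (R₂ := R₂) (S₂ := S₂) g], hτ', hσ,
    hmul'⟩

/-- shifting the exponent by an even integer. [cite: Paul1998, §1.2 (1.2.2) p. 389 L27–29] -/
private theorem cocycleSectionV_shift {R S : Type*} [Fintype R] [DecidableEq R] [Fintype S] [DecidableEq S] {d : ℤ} (e : ℤ)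
    {d' : ℤ} (hd : d + 2 * e = d') (h : ∃ (τ : UForm P Q → MpS (DPIdx P Q R S)) (σ : UForm P Q → ℂˣ),
        (∀ g, proj (τ g) = ι𝕎 P Q R S (g, 1)) ∧ (∀ g, IsMetaplectic (τ g)) ∧
        (∀ g, σ g ^ 2 = Matrix.GeneralLinearGroup.det (g : GL (P ⊕ Q) ℂ) ^ (d : ℤ)) ∧
        ∀ g₁ g₂, τ g₁ * τ g₂ = (if σ g₁ * σ g₂ = σ (g₁ * g₂) then 1 else negOne) * τ (g₁ * g₂)) :
    ∃ (τ : UForm P Q → MpS (DPIdx P Q R S)) (σ : UForm P Q → ℂˣ),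
      (∀ g, proj (τ g) = ι𝕎 P Q R S (g, 1)) ∧ (∀ g, IsMetaplectic (τ g)) ∧
      (∀ g, σ g ^ 2 = Matrix.GeneralLinearGroup.det (g : GL (P ⊕ Q) ℂ) ^ (d' : ℤ)) ∧
      ∀ g₁ g₂, τ g₁ * τ g₂ = (if σ g₁ * σ g₂ = σ (g₁ * g₂) then 1 else negOne) * τ (g₁ * g₂) := by
  obtain ⟨τ, σ, hp, hm, hσ, hmul⟩ := h
  obtain ⟨σ', hσ', hmul'⟩ := cocycle_shift (G := UForm P Q) (UForm.detHom P Q) τ σ e hd hσ hmul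
  exact ⟨τ, σ', hp, hm, hσ', hmul'⟩

set_option maxHeartbeats 1600000 in -- deep index types: slow instance unification
/-- **the negative line from the positive line**: a `CocycleSection 1` datum over `ι_V^{Unit, ∅}` TRANSFERS across the
hyperbolic-pair splitting to a `CocycleSection (−1)` datum over `ι_V^{∅, Unit}`. [cite: Kudla1994, §1, Prop. 4.1; Paul1998, §1.2 (1.2.1)] -/
theorem exists_cocycleSectionV_negLine_of_posLine (h : ∃ (τ : UForm P Q → MpS (DPIdx P Q Unit (Fin 0))) (σ : UForm P Q → ℂˣ),
        (∀ g, proj (τ g) = ι𝕎 P Q Unit (Fin 0) (g, 1)) ∧ (∀ g, IsMetaplectic (τ g)) ∧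
        (∀ g, σ g ^ 2 = Matrix.GeneralLinearGroup.det (g : GL (P ⊕ Q) ℂ) ^ (1 : ℤ)) ∧
        ∀ g₁ g₂, τ g₁ * τ g₂ = (if σ g₁ * σ g₂ = σ (g₁ * g₂) then 1 else negOne) * τ (g₁ * g₂)) :
    ∃ (τ : UForm P Q → MpS (DPIdx P Q (Fin 0) Unit)) (σ : UForm P Q → ℂˣ),
      (∀ g, proj (τ g) = ι𝕎 P Q (Fin 0) Unit (g, 1)) ∧ (∀ g, IsMetaplectic (τ g)) ∧
      (∀ g, σ g ^ 2 = Matrix.GeneralLinearGroup.det (g : GL (P ⊕ Q) ℂ) ^ (-1 : ℤ)) ∧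
      ∀ g₁ g₂, τ g₁ * τ g₂ = (if σ g₁ * σ g₂ = σ (g₁ * g₂) then 1 else negOne) * τ (g₁ * g₂) := by
  -- the hyperbolic pair `(Unit, Unit)` relabelled as `(Unit ⊕ Fin 0, Fin 0 ⊕ Unit)` splits; by additivity this is a
  -- splitting over `g ↦ ι_V^{Unit,Fin 0} g ⊕ ι_V^{Fin 0,Unit} g`
  have e₁ : Unit ≃ Unit ⊕ Fin 0 :=
    Fintype.equivOfCardEq (by simp only [Fintype.card_sum, Fintype.card_fin, Fintype.card_unit])
  have e₂ : Unit ≃ Fin 0 ⊕ Unit :=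
    Fintype.equivOfCardEq (by simp only [Fintype.card_sum, Fintype.card_fin, Fintype.card_unit])
  obtain ⟨s₁, hs₁, hs₁'⟩ := exists_metaplectic_hom_ιV_of_equiv (P := P) (Q := Q) e₁ e₂
    (exists_metaplectic_hom_ιV_pair (P := P) (Q := Q) Unit)
  obtain ⟨s, hs, hs'⟩ := exists_hom_reindex (G := UForm P Q) (dpIdxSumEquiv P Q Unit (Fin 0) (Fin 0) Unit)
    (fun g => ι𝕎 P Q (Unit ⊕ Fin 0) (Fin 0 ⊕ Unit) (g, 1)) s₁ hs₁ hs₁'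
  have hsb : ∀ g, proj (s g) = spBlock (UnitaryDualPairCover.ιV P Q Unit (Fin 0) g, UnitaryDualPairCover.ιV P Q (Fin 0) Unit g) :=
    fun g => by rw [hs, reindexSp_dpIdxSumEquiv_ιV, UnitaryDualPairCover.ιV_apply, UnitaryDualPairCover.ιV_apply]
  obtain ⟨τ₁, σ, h₁, h₁', hσ, hmul⟩ := h
  obtain ⟨τ₂, h₂, h₂', hmul₂⟩ := cocycle_transfer (G := UForm P Q) (UnitaryDualPairCover.ιV P Q Unit (Fin 0))
    (UnitaryDualPairCover.ιV P Q (Fin 0) Unit) s hsb hs' τ₁ σ (fun g => by rw [h₁, UnitaryDualPairCover.ιV_apply]) h₁' hmul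
  exact ⟨τ₂, fun g => (σ g)⁻¹, fun g => by rw [h₂, UnitaryDualPairCover.ιV_apply], h₂', fun g => by rw [inv_pow, hσ, zpow_neg, zpow_one],
    hmul₂⟩

/-- arithmetic of the odd case. [folklore] -/
private theorem odd_decomp {r s : ℕ} (h : Odd (r + s)) :
    (∃ m a : ℕ, r = m + (a + a) + 1 ∧ s = m) ∨ ∃ m b : ℕ, r = m ∧ s = m + (b + b) + 1 := by
  obtain ⟨k, hk⟩ := h
  rcases le_or_gt s r with hsr | hrs
  · exact Or.inl ⟨s, k - s, by omega, rfl⟩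
  · exact Or.inr ⟨r, k - r, rfl, by omega⟩

variable {R S : Type*} [Fintype R] [DecidableEq R] [Fintype S] [DecidableEq S]

set_option maxHeartbeats 1600000 in -- deep index types: slow instance unification
/-- **THE ODD CASE — reduction to ONE line.**  If `|R| + |S|` is odd, the `CocycleSection (|R|−|S|)` fields over
`ι_V^{R,S}` follow from the `CocycleSection 1` fields over `ι_V^{Unit,∅}` (one positive line): the even part of `W` splits
(§2) and is tensored on; for `s > r` the extra negative line's datum is the TRANSFER of the positive one.
[cite: Paul1998, §1.2 (1.2.1)–(1.2.2) p. 389 L11–29; Kudla1994, Prop. 4.1] -/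
theorem exists_cocycleSectionV_of_odd_of_core (hodd : Odd (Fintype.card R + Fintype.card S))
    (hcore : ∃ (τ : UForm P Q → MpS (DPIdx P Q Unit (Fin 0))) (σ : UForm P Q → ℂˣ),
      (∀ g, proj (τ g) = ι𝕎 P Q Unit (Fin 0) (g, 1)) ∧ (∀ g, IsMetaplectic (τ g)) ∧
      (∀ g, σ g ^ 2 = Matrix.GeneralLinearGroup.det (g : GL (P ⊕ Q) ℂ) ^ (1 : ℤ)) ∧
      ∀ g₁ g₂, τ g₁ * τ g₂ = (if σ g₁ * σ g₂ = σ (g₁ * g₂) then 1 else negOne) * τ (g₁ * g₂)) :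
    ∃ (τ : UForm P Q → MpS (DPIdx P Q R S)) (σ : UForm P Q → ℂˣ),
      (∀ g, proj (τ g) = ι𝕎 P Q R S (g, 1)) ∧ (∀ g, IsMetaplectic (τ g)) ∧
      (∀ g, σ g ^ 2 = Matrix.GeneralLinearGroup.det (g : GL (P ⊕ Q) ℂ) ^ ((Fintype.card R : ℤ) - Fintype.card S)) ∧
      ∀ g₁ g₂, τ g₁ * τ g₂ = (if σ g₁ * σ g₂ = σ (g₁ * g₂) then 1 else negOne) * τ (g₁ * g₂) := by
  rcases odd_decomp hodd with ⟨m, a, hr, hs⟩ | ⟨m, b, hr, hs⟩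
  · -- one extra positive line
    have hmodel := cocycleSectionV_sum (exists_metaplectic_hom_ιV_model (Fin m) (Fin a) (Fin 0)) hcore
    have eR : (Fin m ⊕ (Fin a ⊕ Fin a)) ⊕ Unit ≃ R :=
      Fintype.equivOfCardEq (by simp only [Fintype.card_sum, Fintype.card_fin, Fintype.card_unit]; omega)
    have eS : (Fin m ⊕ (Fin 0 ⊕ Fin 0)) ⊕ Fin 0 ≃ S :=
      Fintype.equivOfCardEq (by simp only [Fintype.card_sum, Fintype.card_fin]; omega)
    exact cocycleSectionV_shift (a : ℤ) (by omega) (cocycleSectionV_of_equiv eR eS hmodel)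
  · -- one extra negative line
    have hmodel := cocycleSectionV_sum (exists_metaplectic_hom_ιV_model (Fin m) (Fin 0) (Fin b)) (exists_cocycleSectionV_negLine_of_posLine hcore)
    have eR : (Fin m ⊕ (Fin 0 ⊕ Fin 0)) ⊕ Fin 0 ≃ R :=
      Fintype.equivOfCardEq (by simp only [Fintype.card_sum, Fintype.card_fin]; omega)
    have eS : (Fin m ⊕ (Fin b ⊕ Fin b)) ⊕ Unit ≃ S :=
      Fintype.equivOfCardEq (by simp only [Fintype.card_sum, Fintype.card_fin, Fintype.card_unit]; omega)
    exact cocycleSectionV_shift (-(b : ℤ)) (by omega) (cocycleSectionV_of_equiv eR eS hmodel)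

end Odd

/-! ## 4. Unconditional at `|Q| = 1`: Paul (1.2.1), `V`-side, for `U(P,1) × U(R,S)`, EVERY `(R, S)` -/

section RankOne

variable {P Q R S : Type*} [Fintype P] [DecidableEq P] [Fintype Q] [DecidableEq Q] [Fintype R] [DecidableEq R]
  [Fintype S] [DecidableEq S]

/-- **The core datum at `|Q| = 1` is a tree theorem**: the `CocycleSection 1` fields over `ι_V^{Unit,∅}` for `U(P,1)`
(`exists_cocycleSectionV_linearised` with R1/R2 discharged by `folland1989_Thm_4_37_ab_holds` / `_c_holds`).
[cite: Paul1998, §1.2 (1.2.1)–(1.2.2) p. 389 L11–29; KonnoKonno2007, Lemma 5.2] -/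
theorem exists_cocycleSectionV_core [Subsingleton Q] (p₀ : P) (q₀ : Q) :
    ∃ (τ : UForm P Q → MpS (DPIdx P Q Unit (Fin 0))) (σ : UForm P Q → ℂˣ),
      (∀ g, proj (τ g) = ι𝕎 P Q Unit (Fin 0) (g, 1)) ∧ (∀ g, IsMetaplectic (τ g)) ∧
      (∀ g, σ g ^ 2 = Matrix.GeneralLinearGroup.det (g : GL (P ⊕ Q) ℂ) ^ (1 : ℤ)) ∧
      ∀ g₁ g₂, τ g₁ * τ g₂ = (if σ g₁ * σ g₂ = σ (g₁ * g₂) then 1 else negOne) * τ (g₁ * g₂) := by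
  have h := exists_cocycleSectionV_linearised Unit (Fin 0) p₀ q₀ (folland1989_Thm_4_37_ab_holds _)
    (folland1989_Thm_4_37_c_holds _)
  simpa only [Fintype.card_unit, Fintype.card_fin, Nat.cast_one, Nat.cast_zero, sub_zero] using h

/-- **PAUL 1998 (1.2.1), `V`-SIDE, AT `|Q| = 1`, UNCONDITIONAL**: for `U(P,Q)` with `|Q| = 1` and EVERY second member
`U(R,S)` there are `τ : U(P,Q) → Mp^𝓢(𝕎)` over `ι_V` with metaplectic values and `σ : U(P,Q) → ℂ^×` with
`σ² = det^{|R|−|S|}` such that the metaplectic cocycle of `τ` is the coboundary of `σ` — «`Ũ(p, q)` is isomorphic to the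
`det^{(r−s)/2}`-cover of `U(p, q)`» — with NO hypothesis (no vacuum-character record, no R1/R2, no parity, no `S = ∅`).
[cite: Paul1998, §1.2 (1.2.1)–(1.2.2) p. 389 L11–29; Kudla1994, Prop. 4.1] -/
theorem exists_cocycleSectionV_rankOne [Subsingleton Q] (p₀ : P) (q₀ : Q) :
    ∃ (τ : UForm P Q → MpS (DPIdx P Q R S)) (σ : UForm P Q → ℂˣ),
      (∀ g, proj (τ g) = ι𝕎 P Q R S (g, 1)) ∧ (∀ g, IsMetaplectic (τ g)) ∧
      (∀ g, σ g ^ 2 = Matrix.GeneralLinearGroup.det (g : GL (P ⊕ Q) ℂ) ^ ((Fintype.card R : ℤ) - Fintype.card S)) ∧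
      ∀ g₁ g₂, τ g₁ * τ g₂ = (if σ g₁ * σ g₂ = σ (g₁ * g₂) then 1 else negOne) * τ (g₁ * g₂) := by
  rcases Nat.even_or_odd (Fintype.card R + Fintype.card S) with h | h
  · exact exists_cocycleSectionV_of_even h
  · exact exists_cocycleSectionV_of_odd_of_core h (exists_cocycleSectionV_core p₀ q₀)

end RankOne

end MetaplecticSplitting

end Literature.RepresentationTheory.Paul1998

end
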